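import Mathlib
import Literature.NumberTheory.LFunctions.SuzukiWeilHilbertSpace
import Literature.NumberTheory.LFunctions.SuzukiWeilModelSpace
import Literature.NumberTheory.LFunctions.SuzukiWeilKernelProofs
import Literature.Analysis.Fourier.L2FourierReflection
import Literature.Analysis.Fourier.L2FourierDilation
import HarnessLib

/-!
# The Cauchy multiplier `C_v = 𝖥⁻¹(u − v)⁻¹𝖥` on `L²(t,∞)` and on `V(t)` — Suzuki's `f_w`, `g_w` (axiom (dB3) of CJM Thm. 5.7)

LINE 1 — LABEL: RH-FREE corpus objects and theorems (M. Suzuki, *On the Hilbert space derived from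
the Weil distribution*, Canad. J. Math. 2025 = arXiv:2301.00421v3, proof of Thm. 5.7, axiom (dB3),
TeX l.1929–1946: for `Φ = E·𝖥f ∈ E𝖥(V(t))` with `Φ(w) = 0`, `w ∈ ℂ₊`, the functions
`f_w := f − i(w − w̄)∫₀^{x−t} f(x−y)e^{−iwy}dy ∈ L²(t,∞)` with `𝖥f_w = ((z−w̄)/(z−w))𝖥f` and
`g_w := 𝖪f − i(w̄ − w)∫₀^{x−t}(𝖪f)(x−y)e^{−iw̄y}dy = 𝖪f_w`, supported in `[t,∞)`). bears_on: B-C/B-P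
(LADDER-RH COLUMN 6 DBR) as corpus infrastructure for the RH-CONSEQUENCE fact `Suzuki2025_thm57`.
WHAT THIS IS NOT: `L²`-operator bookkeeping on Suzuki's RH-free spaces `V(t)`; no property of `ζ`
beyond the definitions enters; nothing here bears on the truth of RH.

## Design

Instead of the time-domain Volterra integrals we realise `f ↦ f_w − f` (up to the factor `w − w̄`) as
the bounded Fourier multiplier `C_v f := 𝖥⁻¹[(u − v)⁻¹·𝖥f]` (`v ∉ ℝ`; `cauchyMul`, Mathlib-side
symbol `m̃_v(ξ) = 1/(−2πξ − v)`), so that `C_v` is an `L²(ℝ)`-endomorphism by construction and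
**`𝖪C_v = C_{v̄}𝖪`** (`suzukiK_cauchyMul`) is an a.e. identity of symbols. Everything else is read
off inner products with (translated / reflected) Cauchy vectors by PARTIAL FRACTIONS:
* §A `cauchyFunT w t = 1_{(t,∞)}e^{−iw̄(x−t)}`, `cauchyFunR a t = 1_{(−∞,t)}e^{−iā(t−x)}` with
  `𝖥e_{w,t} = ie^{iut}/(u−w̄)`, `𝖥ě_{a,t} = −ie^{iut}/(u+ā)` a.e., `⟪e_{w,t}, f⟫ = e^{−iwt}f̂(w)` on
  `L²(t,∞)` (`t ≥ 0`), `⟪ě_{a,t}, f⟫ = 0` on `L²(t,∞)`, and the **membership test**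
  `mem_halfLineL2_of_inner_cauchyVecR_eq_zero`: `ψ ⊥ ě_{a,t}` for all `a ∈ ℂ₊` but possibly one
  `⟹ ψ ∈ L²(t,∞)` (injectivity of the half-plane transform on `L²(0,∞)`, the cell's
  `eq_zero_of_upperHalfHat_eq_zero`, applied to `s ↦ ψ(t − s)`; the exceptional point by continuity
  of the holomorphic transform);
* §C `(C_w f)^(z) = (f̂(z) − f̂(w))/(z − w)` (`w, z ∈ ℂ₊`, all `f ∈ L²(ℝ)`) and
  `(C_v f)^(z) = f̂(z)/(z − v)` (`v ∈ ℂ₋`, `f ∈ L²(0,∞)`);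
* §D `C_v(L²(t,∞)) ⊆ L²(t,∞)` for `v ∈ ℂ₋`, and `C_w f ∈ L²(t,∞)` for `w ∈ ℂ₊` when `f̂(w) = 0`;
* §E `blaschkeShift_mem_suzukiV`: `f_w := f + (w − w̄)C_w f ∈ V(t)` with
  `(f_w)^ = ((z−w̄)/(z−w))f̂` on `ℂ₊ ∖ {w}` (`upperHalfHat_blaschkeShift`).

## References
* M. Suzuki, Canad. J. Math. 2025 = arXiv:2301.00421v3, Thm. 5.7 and its proof, p. 16–17
  (TeX l.1844–1946); §2.3–2.4 p. 5. [Suzuki2025WeilHilbertSpace]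
-/

noncomputable section

open MeasureTheory Complex Filter Set FourierTransform
open scoped ComplexConjugate FourierTransform Topology Real ENNReal InnerProductSpace

namespace Literature.NumberTheory.LFunctions

open Literature.Analysis.Fourier

namespace SuzukiBlaschke

/-! ## A. Translated and reflected Cauchy vectors -/

/-- The **translated Cauchy vector** `e_{w,t}(x) := 1_{(t,∞)}(x)·e^{−i w̄ (x−t)}` (`Im w > 0`), an
`L¹ ∩ L²` function supported in `[t,∞)` with `⟪e_{w,t}, f⟫ = e^{−iwt} f̂(w)` for `f ∈ L²(t,∞)`; `t = 0` is
the cell's `cauchyFun`. RH-FREE object. [cite: Suzuki2025WeilHilbertSpace, CJM §2.3 p. 5 (TeX l.615–619: "H² = 𝖥(L²(0,∞))") and Thm. 5.7 proof p. 17 (TeX l.1929–1946)] -/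
def cauchyFunT (w : ℂ) (t : ℝ) (x : ℝ) : ℂ :=
  (Ioi t).indicator (fun x : ℝ ↦ cexp (-(I * conj w * (x - t)))) x

/-- The **reflected Cauchy vector** `ě_{a,t}(x) := 1_{(−∞,t)}(x)·e^{−i ā (t−x)}` (`Im a > 0`), an
`L¹ ∩ L²` function supported in `(−∞,t]`; the family `{ě_{a,t}}_{Im a>0}` tests membership in
`L²(t,∞)` (`mem_halfLineL2_of_inner_cauchyVecR_eq_zero`). RH-FREE object.
[cite: Suzuki2025WeilHilbertSpace, CJM §2.4 eq. (2.7) p. 5 ("H̄² = 𝖥(L²(−∞,0))") and Thm. 5.7 proof p. 17 (TeX l.1929–1946)] -/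
def cauchyFunR (a : ℂ) (t : ℝ) (x : ℝ) : ℂ :=
  (Iio t).indicator (fun x : ℝ ↦ cexp (-(I * conj a * (t - x)))) x

/-- `|e^{−i w̄ s}| = e^{−(Im w)s}` for real `s`. [folklore] -/
private theorem norm_cexp_neg_I_conj_mul' (w : ℂ) (s : ℝ) :
    ‖cexp (-(I * conj w * s))‖ = Real.exp (-(w.im * s)) := by
  rw [Complex.norm_exp]
  congr 1
  simp [Complex.mul_re, Complex.mul_im, Complex.I_re, Complex.I_im, Complex.conj_re,
    Complex.conj_im]

/-- `e_{w,t}` is a.e.-strongly measurable. [cite: Suzuki2025WeilHilbertSpace, CJM §2.3 p. 5 (TeX l.615–619)] -/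
theorem aestronglyMeasurable_cauchyFunT (w : ℂ) (t : ℝ) :
    AEStronglyMeasurable (cauchyFunT w t) volume := by
  unfold cauchyFunT
  exact ((by fun_prop : Continuous fun x : ℝ ↦ cexp (-(I * conj w * (x - t)))).aestronglyMeasurable).indicator
    measurableSet_Ioi

/-- `ě_{a,t}` is a.e.-strongly measurable. [cite: Suzuki2025WeilHilbertSpace, CJM §2.4 p. 5 (TeX l.689–700)] -/
theorem aestronglyMeasurable_cauchyFunR (a : ℂ) (t : ℝ) :
    AEStronglyMeasurable (cauchyFunR a t) volume := by
  unfold cauchyFunR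
  exact ((by fun_prop : Continuous fun x : ℝ ↦ cexp (-(I * conj a * (t - x)))).aestronglyMeasurable).indicator
    measurableSet_Iio

/-- `|e_{w,t}(x)| = 1_{(t,∞)}(x)e^{−Im w (x−t)}`. [cite: Suzuki2025WeilHilbertSpace, CJM §2.3 p. 5 (TeX l.615–619)] -/
theorem norm_cauchyFunT (w : ℂ) (t x : ℝ) :
    ‖cauchyFunT w t x‖ = (Ioi t).indicator (fun x : ℝ ↦ Real.exp (-(w.im * (x - t)))) x := by
  unfold cauchyFunT
  by_cases hx : x ∈ Ioi t
  · rw [indicator_of_mem hx, indicator_of_mem hx]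
    have := norm_cexp_neg_I_conj_mul' w (x - t)
    push_cast at this
    exact this
  · rw [indicator_of_notMem hx, indicator_of_notMem hx, norm_zero]

/-- `|ě_{a,t}(x)| = 1_{(−∞,t)}(x)e^{−Im a (t−x)}`. [cite: Suzuki2025WeilHilbertSpace, CJM §2.4 p. 5 (TeX l.689–700)] -/
theorem norm_cauchyFunR (a : ℂ) (t x : ℝ) :
    ‖cauchyFunR a t x‖ = (Iio t).indicator (fun x : ℝ ↦ Real.exp (-(a.im * (t - x)))) x := by
  unfold cauchyFunR
  by_cases hx : x ∈ Iio t
  · rw [indicator_of_mem hx, indicator_of_mem hx]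
    have := norm_cexp_neg_I_conj_mul' a (t - x)
    push_cast at this
    exact this
  · rw [indicator_of_notMem hx, indicator_of_notMem hx, norm_zero]

/-- `e_{w,t} ∈ L¹(ℝ)` for `Im w > 0`. [cite: Suzuki2025WeilHilbertSpace, CJM §2.3 p. 5 (TeX l.615–619)] -/
theorem integrable_cauchyFunT {w : ℂ} (hw : 0 < w.im) (t : ℝ) : Integrable (cauchyFunT w t) := by
  have h : IntegrableOn (fun x : ℝ ↦ cexp (-(I * conj w * (x - t)))) (Ioi t) := by
    have e : (fun x : ℝ ↦ cexp (-(I * conj w * (x - t)))) =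
        fun x : ℝ ↦ cexp (I * conj w * t) * cexp (-(I * conj w) * x) := by
      funext x; rw [← Complex.exp_add]; ring_nf
    rw [e]
    refine (integrableOn_exp_mul_complex_Ioi ?_ t).const_mul _
    simp [Complex.mul_re, hw]
  unfold cauchyFunT
  exact (integrable_indicator_iff measurableSet_Ioi).2 h

/-- `ě_{a,t} ∈ L¹(ℝ)` for `Im a > 0`. [cite: Suzuki2025WeilHilbertSpace, CJM §2.4 p. 5 (TeX l.689–700)] -/
theorem integrable_cauchyFunR {a : ℂ} (ha : 0 < a.im) (t : ℝ) : Integrable (cauchyFunR a t) := by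
  have h : IntegrableOn (fun x : ℝ ↦ cexp (-(I * conj a * (t - x)))) (Iio t) := by
    have e : (fun x : ℝ ↦ cexp (-(I * conj a * (t - x)))) =
        fun x : ℝ ↦ cexp (-(I * conj a * t)) * cexp ((I * conj a) * x) := by
      funext x; rw [← Complex.exp_add]; ring_nf
    rw [e]
    refine ((integrableOn_exp_mul_complex_Iic ?_ t).mono_set Iio_subset_Iic_self).const_mul _
    simp [Complex.mul_re, ha]
  unfold cauchyFunR
  exact (integrable_indicator_iff measurableSet_Iio).2 h

/-- `e_{w,t} ∈ L²(ℝ)` for `Im w > 0`. [cite: Suzuki2025WeilHilbertSpace, CJM §2.3 p. 5 (TeX l.615–619)] -/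
theorem memLp_cauchyFunT {w : ℂ} (hw : 0 < w.im) (t : ℝ) : MemLp (cauchyFunT w t) 2 volume := by
  refine (memLp_two_iff_integrable_sq_norm (aestronglyMeasurable_cauchyFunT w t)).2 ?_
  have h : IntegrableOn (fun x : ℝ ↦ Real.exp (2 * w.im * t) * Real.exp (-(2 * w.im) * x)) (Ioi t) :=
    (exp_neg_integrableOn_Ioi t (by linarith)).const_mul _
  have e : (fun x : ℝ ↦ ‖cauchyFunT w t x‖ ^ 2) =
      (Ioi t).indicator fun x : ℝ ↦ Real.exp (2 * w.im * t) * Real.exp (-(2 * w.im) * x) := by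
    funext x
    rw [norm_cauchyFunT]
    by_cases hx : x ∈ Ioi t
    · rw [indicator_of_mem hx, indicator_of_mem hx, ← Real.exp_nat_mul, ← Real.exp_add]
      congr 1; push_cast; ring
    · rw [indicator_of_notMem hx, indicator_of_notMem hx, zero_pow two_ne_zero]
  rw [e, integrable_indicator_iff measurableSet_Ioi]
  exact h

/-- `ě_{a,t} ∈ L²(ℝ)` for `Im a > 0`. [cite: Suzuki2025WeilHilbertSpace, CJM §2.4 p. 5 (TeX l.689–700)] -/
theorem memLp_cauchyFunR {a : ℂ} (ha : 0 < a.im) (t : ℝ) : MemLp (cauchyFunR a t) 2 volume := by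
  refine (memLp_two_iff_integrable_sq_norm (aestronglyMeasurable_cauchyFunR a t)).2 ?_
  have h : IntegrableOn (fun x : ℝ ↦ Real.exp (-(2 * a.im * t)) * Real.exp ((2 * a.im) * x)) (Iio t) :=
    ((integrableOn_exp_mul_Iic (by linarith : 0 < 2 * a.im) t).mono_set Iio_subset_Iic_self).const_mul _
  have e : (fun x : ℝ ↦ ‖cauchyFunR a t x‖ ^ 2) =
      (Iio t).indicator fun x : ℝ ↦ Real.exp (-(2 * a.im * t)) * Real.exp ((2 * a.im) * x) := by
    funext x
    rw [norm_cauchyFunR]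
    by_cases hx : x ∈ Iio t
    · rw [indicator_of_mem hx, indicator_of_mem hx, ← Real.exp_nat_mul, ← Real.exp_add]
      congr 1; push_cast; ring
    · rw [indicator_of_notMem hx, indicator_of_notMem hx, zero_pow two_ne_zero]
  rw [e, integrable_indicator_iff measurableSet_Iio]
  exact h

/-- The translated Cauchy vector as an `L²(ℝ)`-class (junk `0` unless `Im w > 0`). RH-FREE object.
[cite: Suzuki2025WeilHilbertSpace, CJM §2.3 p. 5 (TeX l.615–619) and Thm. 5.7 proof p. 17] -/
def cauchyVecT (w : ℂ) (t : ℝ) : Lp ℂ 2 (volume : Measure ℝ) :=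
  if hw : 0 < w.im then (memLp_cauchyFunT hw t).toLp (cauchyFunT w t) else 0

/-- The reflected Cauchy vector as an `L²(ℝ)`-class (junk `0` unless `Im a > 0`). RH-FREE object.
[cite: Suzuki2025WeilHilbertSpace, CJM §2.4 p. 5 (TeX l.689–700) and Thm. 5.7 proof p. 17] -/
def cauchyVecR (a : ℂ) (t : ℝ) : Lp ℂ 2 (volume : Measure ℝ) :=
  if ha : 0 < a.im then (memLp_cauchyFunR ha t).toLp (cauchyFunR a t) else 0

/-- `cauchyVecT w t` is represented by `e_{w,t}`. [cite: Suzuki2025WeilHilbertSpace, CJM §2.3 p. 5 (TeX l.615–619)] -/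
theorem coeFn_cauchyVecT {w : ℂ} (hw : 0 < w.im) (t : ℝ) :
    (cauchyVecT w t : ℝ → ℂ) =ᵐ[volume] cauchyFunT w t := by
  unfold cauchyVecT; rw [dif_pos hw]; exact MemLp.coeFn_toLp _

/-- `cauchyVecR a t` is represented by `ě_{a,t}`. [cite: Suzuki2025WeilHilbertSpace, CJM §2.4 p. 5 (TeX l.689–700)] -/
theorem coeFn_cauchyVecR {a : ℂ} (ha : 0 < a.im) (t : ℝ) :
    (cauchyVecR a t : ℝ → ℂ) =ᵐ[volume] cauchyFunR a t := by
  unfold cauchyVecR; rw [dif_pos ha]; exact MemLp.coeFn_toLp _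

/-- Suzuki's transform of `e_{w,t}`: `(e_{w,t})^(u) = i e^{iut}/(u − w̄)` (real `u`).
[cite: Suzuki2025WeilHilbertSpace, CJM eq. (1.1) p. 2 and §2.3 p. 5] -/
theorem suzukiHat_cauchyFunT {w : ℂ} (hw : 0 < w.im) (t u : ℝ) :
    suzukiHat (cauchyFunT w t) u = I * cexp (I * u * t) / (u - conj w) := by
  unfold suzukiHat cauchyFunT
  have hb : (I * ((u : ℂ) - conj w)).re < 0 := by
    simp [Complex.mul_re, Complex.sub_im, Complex.conj_im]; linarith
  have hne : (u : ℂ) - conj w ≠ 0 := by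
    intro h; rw [h, mul_zero, Complex.zero_re] at hb; exact lt_irrefl _ hb
  calc ∫ x : ℝ, (Ioi t).indicator (fun x : ℝ ↦ cexp (-(I * conj w * (x - t)))) x * cexp (I * u * x)
      = ∫ x in Ioi t, cexp (I * conj w * t) * cexp (I * ((u : ℂ) - conj w) * x) := by
        rw [← integral_indicator measurableSet_Ioi]
        refine integral_congr_ae (Eventually.of_forall fun x ↦ ?_)
        simp only
        by_cases hx : x ∈ Ioi t
        · rw [indicator_of_mem hx, indicator_of_mem hx, ← Complex.exp_add, ← Complex.exp_add]
          congr 1; ring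
        · rw [indicator_of_notMem hx, indicator_of_notMem hx, zero_mul]
    _ = cexp (I * conj w * t) * (-cexp (I * ((u : ℂ) - conj w) * t) / (I * ((u : ℂ) - conj w))) := by
        rw [integral_const_mul, integral_exp_mul_complex_Ioi hb t]
    _ = I * cexp (I * u * t) / (u - conj w) := by
        have e : I * conj w * ↑t + I * (↑u - conj w) * ↑t = I * u * t := by ring
        rw [mul_div_assoc', ← neg_mul_eq_mul_neg, ← Complex.exp_add, e]
        field_simp
        rw [Complex.I_sq]

/-- Suzuki's transform of `ě_{a,t}`: `(ě_{a,t})^(u) = −i e^{iut}/(u + ā)` (real `u`).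
[cite: Suzuki2025WeilHilbertSpace, CJM eq. (1.1) p. 2 and §2.4 p. 5] -/
theorem suzukiHat_cauchyFunR {a : ℂ} (ha : 0 < a.im) (t u : ℝ) :
    suzukiHat (cauchyFunR a t) u = -I * cexp (I * u * t) / (u + conj a) := by
  unfold suzukiHat cauchyFunR
  have hb : 0 < (I * ((u : ℂ) + conj a)).re := by
    simp [Complex.mul_re, Complex.add_im, Complex.conj_im]; linarith
  have hne : (u : ℂ) + conj a ≠ 0 := by
    intro h; rw [h, mul_zero, Complex.zero_re] at hb; exact lt_irrefl _ hb
  calc ∫ x : ℝ, (Iio t).indicator (fun x : ℝ ↦ cexp (-(I * conj a * (t - x)))) x * cexp (I * u * x)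
      = ∫ x in Iic t, cexp (-(I * conj a * t)) * cexp (I * ((u : ℂ) + conj a) * x) := by
        rw [setIntegral_congr_set Iio_ae_eq_Iic.symm, ← integral_indicator measurableSet_Iio]
        refine integral_congr_ae (Eventually.of_forall fun x ↦ ?_)
        simp only
        by_cases hx : x ∈ Iio t
        · rw [indicator_of_mem hx, indicator_of_mem hx, ← Complex.exp_add, ← Complex.exp_add]
          congr 1; ring
        · rw [indicator_of_notMem hx, indicator_of_notMem hx, zero_mul]
    _ = cexp (-(I * conj a * t)) * (cexp (I * ((u : ℂ) + conj a) * t) / (I * ((u : ℂ) + conj a))) := by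
        rw [integral_const_mul, integral_exp_mul_complex_Iic hb t]
    _ = -I * cexp (I * u * t) / (u + conj a) := by
        have e : -(I * conj a * ↑t) + I * (↑u + conj a) * ↑t = I * u * t := by ring
        rw [mul_div_assoc', ← Complex.exp_add, e]
        field_simp
        rw [Complex.I_sq]; ring

/-- **`𝖥e_{w,t} = i e^{iut}/(u − w̄)` a.e.** [cite: Suzuki2025WeilHilbertSpace, CJM §2.3 p. 5 (TeX l.615–619)] -/
theorem suzukiFourierL2_cauchyVecT {w : ℂ} (hw : 0 < w.im) (t : ℝ) :
    (suzukiFourierL2 (cauchyVecT w t) : ℝ → ℂ) =ᵐ[volume]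
      fun u : ℝ ↦ I * cexp (I * u * t) / (u - conj w) := by
  unfold cauchyVecT; rw [dif_pos hw]
  filter_upwards [suzukiFourierL2_toLp_ae_eq_suzukiHat (integrable_cauchyFunT hw t)
    (memLp_cauchyFunT hw t)] with u hu
  rw [hu, suzukiHat_cauchyFunT hw]

/-- **`𝖥ě_{a,t} = −i e^{iut}/(u + ā)` a.e.** [cite: Suzuki2025WeilHilbertSpace, CJM §2.4 p. 5 (TeX l.689–700)] -/
theorem suzukiFourierL2_cauchyVecR {a : ℂ} (ha : 0 < a.im) (t : ℝ) :
    (suzukiFourierL2 (cauchyVecR a t) : ℝ → ℂ) =ᵐ[volume]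
      fun u : ℝ ↦ -I * cexp (I * u * t) / (u + conj a) := by
  unfold cauchyVecR; rw [dif_pos ha]
  filter_upwards [suzukiFourierL2_toLp_ae_eq_suzukiHat (integrable_cauchyFunR ha t)
    (memLp_cauchyFunR ha t)] with u hu
  rw [hu, suzukiHat_cauchyFunR ha]

/-- `ě_{a,t}` vanishes on `[t, ∞)`; hence **`⟪ě_{a,t}, f⟫ = 0` for every `f ∈ L²(t,∞)`**
(`L²(−∞,t) ⊥ L²(t,∞)`). [cite: Suzuki2025WeilHilbertSpace, CJM §2.4 eq. (2.7) p. 5 (TeX l.689–700)] -/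
theorem inner_cauchyVecR_eq_zero_of_mem {a : ℂ} (ha : 0 < a.im) {t : ℝ}
    {f : Lp ℂ 2 (volume : Measure ℝ)} (hf : f ∈ halfLineL2 t) :
    inner ℂ (cauchyVecR a t) f = 0 := by
  rw [inner_L2_eq_integral]
  refine (integral_congr_ae ?_).trans (integral_zero ℝ ℂ)
  have hf' : ∀ᵐ x : ℝ, x < t → (f : ℝ → ℂ) x = 0 := hf
  filter_upwards [coeFn_cauchyVecR ha t, hf'] with x hx hfx
  rw [hx]
  by_cases hxt : x < t
  · rw [hfx hxt, mul_zero]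
  · rw [cauchyFunR, indicator_of_notMem (by simpa using hxt), map_zero, zero_mul]

/-- `conj e^{−i w̄ (x−t)} = e^{−iwt}·e^{iwx}` for real `x, t`. [cite: Suzuki2025WeilHilbertSpace, CJM §2.3 p. 5 (TeX l.615–619)] -/
theorem conj_cexp_cauchyT (w : ℂ) (x t : ℝ) :
    conj (cexp (-(I * conj w * ((x : ℂ) - t)))) = cexp (-(I * w * t)) * cexp (I * w * x) := by
  rw [← Complex.exp_conj, ← Complex.exp_add]
  congr 1
  simp only [map_neg, map_mul, Complex.conj_I, Complex.conj_conj, map_sub, Complex.conj_ofReal]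
  ring

/-- **`⟪e_{w,t}, f⟫ = e^{−iwt} f̂(w)` for `f ∈ L²(t,∞)`, `t ≥ 0`** (so it vanishes when `f̂(w) = 0`).
[cite: Suzuki2025WeilHilbertSpace, CJM Thm. 5.7 proof p. 17 (TeX l.1929–1935: "(𝖥f)(w) = 0")] -/
theorem inner_cauchyVecT {w : ℂ} (hw : 0 < w.im) {t : ℝ} (ht : 0 ≤ t)
    {f : Lp ℂ 2 (volume : Measure ℝ)} (hf : f ∈ halfLineL2 t) :
    inner ℂ (cauchyVecT w t) f = cexp (-(I * w * t)) * upperHalfHat f w := by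
  have hf' : ∀ᵐ x : ℝ, x < t → (f : ℝ → ℂ) x = 0 := hf
  have hne : ∀ᵐ x : ℝ, x ≠ t := by
    have : ({t}ᶜ : Set ℝ) ∈ ae (volume : Measure ℝ) := by
      rw [compl_mem_ae_iff, measure_singleton]
    exact this
  rw [inner_L2_eq_integral, upperHalfHat, ← integral_indicator measurableSet_Ioi, ← integral_const_mul]
  refine integral_congr_ae ?_
  filter_upwards [coeFn_cauchyVecT hw t, hf', hne] with x hx hfx hxne
  rw [hx, cauchyFunT]
  rcases lt_or_gt_of_ne hxne with hxt | hxt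
  · rw [indicator_of_notMem (show x ∉ Ioi t from fun h ↦ lt_asymm h hxt), map_zero, zero_mul]
    by_cases hx0 : x ∈ Ioi (0 : ℝ)
    · rw [indicator_of_mem hx0, hfx hxt, zero_mul, mul_zero]
    · rw [indicator_of_notMem hx0, mul_zero]
  · have hx0 : x ∈ Ioi (0 : ℝ) := lt_of_le_of_lt ht hxt
    rw [indicator_of_mem (show x ∈ Ioi t from hxt), indicator_of_mem hx0, conj_cexp_cauchyT]
    ring

/-- `conj e^{−i ā s} = e^{i a conj s}`. [cite: Suzuki2025WeilHilbertSpace, CJM §2.4 p. 5 (TeX l.689–700)] -/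
theorem conj_cexp_cauchyR (a s : ℂ) : conj (cexp (-(I * conj a * s))) = cexp (I * a * conj s) := by
  rw [← Complex.exp_conj]
  congr 1
  simp only [map_neg, map_mul, Complex.conj_I, Complex.conj_conj]
  ring

/-- **`⟪ě_{a,t}, ψ⟫ = ∫₀^∞ ψ(t − s) e^{ias} ds`** — the inner product against the reflected Cauchy
vector is the half-plane transform, at `a`, of the reflected–translated function `s ↦ ψ(t − s)`
restricted to `(0,∞)`. [cite: Suzuki2025WeilHilbertSpace, CJM §2.4 eq. (2.7) p. 5 (TeX l.689–700)] -/
theorem inner_cauchyVecR_eq_integral {a : ℂ} (ha : 0 < a.im) (t : ℝ) (ψ : Lp ℂ 2 (volume : Measure ℝ)) :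
    inner ℂ (cauchyVecR a t) ψ = ∫ s in Ioi (0 : ℝ), (ψ : ℝ → ℂ) (t - s) * cexp (I * a * s) := by
  set H : ℝ → ℂ := (Ioi (0 : ℝ)).indicator fun s : ℝ ↦ (ψ : ℝ → ℂ) (t - s) * cexp (I * a * s)
    with hH
  rw [inner_L2_eq_integral, ← integral_indicator measurableSet_Ioi,
    ← integral_sub_left_eq_self H volume t]
  refine integral_congr_ae ?_
  filter_upwards [coeFn_cauchyVecR ha t] with x hx
  rw [hx, cauchyFunR, hH]
  by_cases hxt : x < t
  · have h0 : t - x ∈ Ioi (0 : ℝ) := sub_pos.2 hxt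
    rw [indicator_of_mem (mem_Iio.2 hxt), indicator_of_mem h0, conj_cexp_cauchyR, sub_sub_cancel,
      mul_comm]
    congr 2
    simp only [map_sub, Complex.conj_ofReal]
    push_cast
    ring
  · have h0 : t - x ∉ Ioi (0 : ℝ) := fun h ↦ hxt (sub_pos.1 h)
    rw [indicator_of_notMem (fun h ↦ hxt (mem_Iio.1 h)), indicator_of_notMem h0, map_zero, zero_mul]

/-- **The reflected Cauchy vectors test membership in `L²(t,∞)`**: if `ψ ∈ L²(ℝ)` is orthogonal to
`ě_{a,t}` for every `a ∈ ℂ₊`, then `ψ` vanishes a.e. on `(−∞,t)` (injectivity of the half-plane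
transform on `L²(0,∞)`, the cell's `eq_zero_of_upperHalfHat_eq_zero`, applied to `s ↦ ψ(t−s)`).
RH-FREE. [cite: Suzuki2025WeilHilbertSpace, CJM §2.3–2.4 p. 5 (TeX l.615–700: "H² = 𝖥(L²(0,∞))", "H̄² = 𝖥(L²(−∞,0))")] -/
theorem mem_halfLineL2_of_inner_cauchyVecR_eq_zero {t : ℝ} {ψ : Lp ℂ 2 (volume : Measure ℝ)}
    (a₀ : ℂ) (h : ∀ a : ℂ, 0 < a.im → a ≠ a₀ → inner ℂ (cauchyVecR a t) ψ = 0) :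
    ψ ∈ halfLineL2 t := by
  have hmp := Measure.measurePreserving_sub_left (volume : Measure ℝ) t
  set R : Lp ℂ 2 (volume : Measure ℝ) := Lp.compMeasurePreserving (fun x : ℝ ↦ t - x) hmp ψ with hRdef
  have hR : (R : ℝ → ℂ) =ᵐ[volume] fun s ↦ (ψ : ℝ → ℂ) (t - s) := Lp.coeFn_compMeasurePreserving ψ hmp
  set χ : Lp ℂ 2 (volume : Measure ℝ) :=
    ((Lp.memLp R).indicator measurableSet_Ioi).toLp ((Ioi (0 : ℝ)).indicator (R : ℝ → ℂ)) with hχdef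
  have hχ : (χ : ℝ → ℂ) =ᵐ[volume] (Ioi (0 : ℝ)).indicator (R : ℝ → ℂ) := MemLp.coeFn_toLp _
  have hχ0 : χ ∈ halfLineL2 0 := by
    show ∀ᵐ x : ℝ ∂volume, x < 0 → (χ : ℝ → ℂ) x = 0
    filter_upwards [hχ] with x hx hx0
    rw [hx, indicator_of_notMem (show x ∉ Ioi (0 : ℝ) from fun h' ↦ lt_asymm hx0 h')]
  have hhat_eq : ∀ a : ℂ, 0 < a.im → upperHalfHat χ a = inner ℂ (cauchyVecR a t) ψ := by
    intro a ha
    rw [inner_cauchyVecR_eq_integral ha, upperHalfHat]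
    refine setIntegral_congr_ae measurableSet_Ioi ?_
    filter_upwards [hχ, hR] with s h1 h2 hs
    rw [h1, indicator_of_mem hs, h2]
  have hhat' : ∀ a : ℂ, 0 < a.im → a ≠ a₀ → upperHalfHat χ a = 0 := fun a ha hne ↦ by
    rw [hhat_eq a ha, h a ha hne]
  -- the exceptional point `a₀` by continuity of the holomorphic `χ̂` on `ℂ₊`
  have hhat : ∀ a : ℂ, 0 < a.im → upperHalfHat χ a = 0 := by
    intro a ha
    rcases ne_or_eq a a₀ with hne | rfl
    · exact hhat' a ha hne
    have hopen : IsOpen {z : ℂ | 0 < z.im} := isOpen_lt continuous_const Complex.continuous_im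
    have hcont : ContinuousAt (upperHalfHat χ) a :=
      ((differentiableOn_upperHalfHat χ).differentiableAt (hopen.mem_nhds ha)).continuousAt
    have hev : ∀ᶠ z in 𝓝[≠] a, upperHalfHat χ z = 0 := by
      have h1 : ∀ᶠ z in 𝓝[≠] a, 0 < z.im :=
        mem_nhdsWithin_of_mem_nhds (hopen.mem_nhds ha)
      filter_upwards [h1, self_mem_nhdsWithin] with z hz hne
      exact hhat' z hz hne
    have hlim : Tendsto (upperHalfHat χ) (𝓝[≠] a) (𝓝 0) :=
      (tendsto_congr' hev).2 tendsto_const_nhds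
    exact tendsto_nhds_unique (hcont.tendsto.mono_left nhdsWithin_le_nhds) hlim
  have hχz : χ = 0 := eq_zero_of_upperHalfHat_eq_zero hχ0 hhat
  have hae : ∀ᵐ s : ℝ, 0 < s → (ψ : ℝ → ℂ) (t - s) = 0 := by
    have h0 : (χ : ℝ → ℂ) =ᵐ[volume] 0 := by rw [hχz]; exact Lp.coeFn_zero ℂ 2 volume
    filter_upwards [h0, hχ, hR] with s h1 h2 h3 hs
    have := h1.symm.trans h2
    rw [Pi.zero_apply, indicator_of_mem (show s ∈ Ioi (0 : ℝ) from hs), h3] at this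
    exact this.symm
  show ∀ᵐ x : ℝ ∂volume, x < t → (ψ : ℝ → ℂ) x = 0
  filter_upwards [hmp.quasiMeasurePreserving.ae hae] with x hx hxt
  have := hx (sub_pos.2 hxt)
  rwa [sub_sub_cancel] at this

/-- `e_{w,t} ∈ L²(t,∞)`. [cite: Suzuki2025WeilHilbertSpace, CJM §2.3 p. 5 (TeX l.615–619)] -/
theorem cauchyVecT_mem_halfLineL2 {w : ℂ} (hw : 0 < w.im) (t : ℝ) : cauchyVecT w t ∈ halfLineL2 t := by
  show ∀ᵐ x : ℝ ∂volume, x < t → (cauchyVecT w t : ℝ → ℂ) x = 0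
  filter_upwards [coeFn_cauchyVecT hw t] with x hx hxt
  rw [hx, cauchyFunT, indicator_of_notMem (show x ∉ Ioi t from fun h ↦ lt_asymm hxt h)]

/-! ## B. The Cauchy multiplier `C_v f := 𝖥⁻¹[(u − v)⁻¹·𝖥f]` -/

/-- The Fourier-side symbol of `C_v` in Mathlib's normalisation: `m̃_v(ξ) := 1/((−2πξ) − v)` (so that
`m̃_v(−u/2π) = 1/(u − v)`). [cite: Suzuki2025WeilHilbertSpace, CJM Thm. 5.7 proof p. 17 (TeX l.1929–1946: "(𝖥f_w)(z) = ((z − w̄)/(z − w))(𝖥f)(z)")] -/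
def cauchySymbol (v : ℂ) (ξ : ℝ) : ℂ := 1 / (((-2 * Real.pi * ξ : ℝ) : ℂ) - v)

/-- `|m̃_v| ≤ 1/|Im v|`. [cite: Suzuki2025WeilHilbertSpace, CJM Thm. 5.7 proof p. 17 (TeX l.1929–1946)] -/
theorem norm_cauchySymbol_le {v : ℂ} (hv : v.im ≠ 0) (ξ : ℝ) : ‖cauchySymbol v ξ‖ ≤ 1 / |v.im| := by
  unfold cauchySymbol
  rw [norm_div, norm_one]
  refine one_div_le_one_div_of_le (abs_pos.2 hv) ?_
  calc |v.im| = |((((-2 * Real.pi * ξ : ℝ) : ℂ) - v).im)| := by simp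
    _ ≤ ‖((-2 * Real.pi * ξ : ℝ) : ℂ) - v‖ := Complex.abs_im_le_norm _

/-- `m̃_v` is measurable (indeed continuous off one point; we only use measurability).
[cite: Suzuki2025WeilHilbertSpace, CJM Thm. 5.7 proof p. 17 (TeX l.1929–1946)] -/
theorem measurable_cauchySymbol (v : ℂ) : Measurable (cauchySymbol v) := by
  have h : Measurable fun ξ : ℝ ↦ ((-2 * Real.pi * ξ : ℝ) : ℂ) - v :=
    (Complex.measurable_ofReal.comp (measurable_const.mul measurable_id)).sub_const v
  exact (measurable_const.div h : Measurable fun ξ : ℝ ↦ (1 : ℂ) / (((-2 * Real.pi * ξ : ℝ) : ℂ) - v))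

/-- `conj m̃_v = m̃_{v̄}`. [cite: Suzuki2025WeilHilbertSpace, CJM Thm. 5.7 proof p. 17 (TeX l.1940–1946: "𝖥g_w = ((z−w)/(z−w̄))𝖥𝖪f")] -/
theorem conj_cauchySymbol (v : ℂ) (ξ : ℝ) : conj (cauchySymbol v ξ) = cauchySymbol (conj v) ξ := by
  unfold cauchySymbol
  simp only [map_div₀, map_one, map_sub, Complex.conj_ofReal]

/-- `m̃_v·G ∈ L²` for `G ∈ L²`. [cite: Suzuki2025WeilHilbertSpace, CJM Thm. 5.7 proof p. 17 (TeX l.1929–1946)] -/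
theorem memLp_cauchySymbol_mul {v : ℂ} (hv : v.im ≠ 0) (G : Lp ℂ 2 (volume : Measure ℝ)) :
    MemLp (fun ξ : ℝ ↦ cauchySymbol v ξ * G ξ) 2 volume := by
  refine MemLp.of_le_mul (c := 1 / |v.im|) (Lp.memLp G)
    ((measurable_cauchySymbol v).aestronglyMeasurable.mul (Lp.aestronglyMeasurable G))
    (Eventually.of_forall fun ξ ↦ ?_)
  rw [norm_mul]
  exact mul_le_mul_of_nonneg_right (norm_cauchySymbol_le hv ξ) (norm_nonneg _)

/-- The Fourier-side multiplication by `m̃_v` on `L²(ℝ)` (junk `0` for real `v`).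
[cite: Suzuki2025WeilHilbertSpace, CJM Thm. 5.7 proof p. 17 (TeX l.1929–1946)] -/
def mulCauchy (v : ℂ) (G : Lp ℂ 2 (volume : Measure ℝ)) : Lp ℂ 2 (volume : Measure ℝ) :=
  if hv : v.im ≠ 0 then (memLp_cauchySymbol_mul hv G).toLp _ else 0

/-- `mulCauchy v G = m̃_v·G` a.e. [cite: Suzuki2025WeilHilbertSpace, CJM Thm. 5.7 proof p. 17 (TeX l.1929–1946)] -/
theorem coeFn_mulCauchy {v : ℂ} (hv : v.im ≠ 0) (G : Lp ℂ 2 (volume : Measure ℝ)) :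
    (mulCauchy v G : ℝ → ℂ) =ᵐ[volume] fun ξ ↦ cauchySymbol v ξ * G ξ := by
  unfold mulCauchy; rw [dif_pos hv]; exact MemLp.coeFn_toLp _

/-- **The Cauchy multiplier `C_v f := 𝖥⁻¹[(u − v)⁻¹ 𝖥f]` on `L²(ℝ)`** (`v ∉ ℝ`): the `L²`-bounded
operator behind Suzuki's `f_w = f − i(w − w̄)∫₀^{x−t} f(x−y)e^{−iwy}dy`, whose transform is
`((z − w̄)/(z − w))(𝖥f)(z) = (𝖥f)(z) + (w − w̄)(𝖥f)(z)/(z − w)`. RH-FREE object.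
[cite: Suzuki2025WeilHilbertSpace, CJM Thm. 5.7 proof p. 17 (TeX l.1929–1946)] -/
def cauchyMul (v : ℂ) (f : Lp ℂ 2 (volume : Measure ℝ)) : Lp ℂ 2 (volume : Measure ℝ) :=
  𝓕⁻ (mulCauchy v (𝓕 f : Lp ℂ 2 (volume : Measure ℝ)))

/-- **`𝖥(C_v f) = (u − v)⁻¹·𝖥f` a.e.** (Suzuki's normalisation `𝖥 = suzukiFourierL2`).
[cite: Suzuki2025WeilHilbertSpace, CJM Thm. 5.7 proof p. 17 (TeX l.1929–1946)] -/
theorem suzukiFourierL2_cauchyMul {v : ℂ} (hv : v.im ≠ 0) (f : Lp ℂ 2 (volume : Measure ℝ)) :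
    (suzukiFourierL2 (cauchyMul v f) : ℝ → ℂ) =ᵐ[volume]
      fun u : ℝ ↦ 1 / ((u : ℂ) - v) * (suzukiFourierL2 f : ℝ → ℂ) u := by
  have hc : (2 * Real.pi)⁻¹ ≠ 0 := inv_ne_zero Real.two_pi_pos.ne'
  have hq := (measurePreserving_mul_left hc).quasiMeasurePreserving.mono_right
    Measure.smul_absolutelyContinuous
  have hqn : Measure.QuasiMeasurePreserving (fun x : ℝ ↦ -x) volume volume :=
    (Measure.measurePreserving_neg (volume : Measure ℝ)).quasiMeasurePreserving
  set X : Lp ℂ 2 (volume : Measure ℝ) := mulCauchy v (𝓕 f : Lp ℂ 2 (volume : Measure ℝ)) with hX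
  have h1 : ∀ᵐ ξ : ℝ, ((𝓕⁻ (𝓕⁻ X : Lp ℂ 2 (volume : Measure ℝ)) : Lp ℂ 2 (volume : Measure ℝ)) : ℝ → ℂ) ξ
      = cauchySymbol v (-ξ) * ((𝓕 f : Lp ℂ 2 (volume : Measure ℝ)) : ℝ → ℂ) (-ξ) := by
    rw [fourierInv_fourierInv_eq_compNeg]
    filter_upwards [coeFn_compNeg X, hqn.ae (coeFn_mulCauchy hv (𝓕 f : Lp ℂ 2 (volume : Measure ℝ)))]
      with ξ e1 e2
    rw [e1, e2]
  have h2 : ∀ᵐ ξ : ℝ, ((𝓕 f : Lp ℂ 2 (volume : Measure ℝ)) : ℝ → ℂ) (-ξ) =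
      ((𝓕⁻ f : Lp ℂ 2 (volume : Measure ℝ)) : ℝ → ℂ) ξ := by
    rw [fourierInv_eq_compNeg_fourier]
    filter_upwards [coeFn_compNeg (𝓕 f : Lp ℂ 2 (volume : Measure ℝ))] with ξ e
    rw [e]
  filter_upwards [coeFn_suzukiFourierL2 (cauchyMul v f), coeFn_suzukiFourierL2 f, hq.ae h1, hq.ae h2]
    with u e1 e2 e3 e4
  rw [e1, cauchyMul, ← hX, e3, e4, e2]
  congr 1
  unfold cauchySymbol
  congr 1
  push_cast
  field_simp

/-- **`𝖪 C_v = C_{v̄} 𝖪`** on `L²(ℝ)` (`𝖪 = 𝖥⁻¹𝖬_Θ𝖩𝖥` and `𝖩(m̃_v G) = m̃_{v̄}·𝖩G`): the printed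
"`𝖥g_w = ((z−w)/(z−w̄))𝖥𝖪f = 𝖥𝖪f_w`, hence `g_w = 𝖪f_w`". RH-FREE.
[cite: Suzuki2025WeilHilbertSpace, CJM Thm. 5.7 proof p. 17 (TeX l.1940–1946)] -/
theorem suzukiK_cauchyMul {v : ℂ} (hv : v.im ≠ 0) (f : Lp ℂ 2 (volume : Measure ℝ)) :
    suzukiK (cauchyMul v f) = cauchyMul (conj v) (suzukiK f) := by
  have hv' : (conj v).im ≠ 0 := by simpa using hv
  set G : Lp ℂ 2 (volume : Measure ℝ) := (𝓕 f : Lp ℂ 2 (volume : Measure ℝ)) with hG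
  have hL : suzukiK (cauchyMul v f) = 𝓕⁻ (suzukiM (suzukiJ (mulCauchy v G))) := by
    rw [suzukiK, cauchyMul, ← hG, fourier_fourierInv_eq]
  have hR : cauchyMul (conj v) (suzukiK f) = 𝓕⁻ (mulCauchy (conj v) (suzukiM (suzukiJ G))) := by
    rw [cauchyMul, suzukiK, ← hG, fourier_fourierInv_eq]
  rw [hL, hR]
  congr 1
  refine Lp.ext ?_
  filter_upwards [coeFn_suzukiM (suzukiJ (mulCauchy v G)), coeFn_suzukiJ (mulCauchy v G),
    coeFn_mulCauchy hv G, coeFn_mulCauchy hv' (suzukiM (suzukiJ G)), coeFn_suzukiM (suzukiJ G),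
    coeFn_suzukiJ G] with ξ e1 e2 e3 e4 e5 e6
  rw [e1, e2, e3, e4, e5, e6, map_mul, conj_cauchySymbol]
  ring

/-! ## C. The transform of `C_v f` on the upper half-plane -/

/-- `u − z ≠ 0` for real `u` and non-real `z`. [folklore] -/
private theorem ofReal_sub_ne_zero {z : ℂ} (hz : z.im ≠ 0) (u : ℝ) : (u : ℂ) - z ≠ 0 := by
  intro h
  have := congrArg Complex.im h
  simp at this
  exact hz (by linarith)

/-- `u + a ≠ 0` for real `u` and non-real `a`. [folklore] -/
private theorem ofReal_add_ne_zero {a : ℂ} (ha : a.im ≠ 0) (u : ℝ) : (u : ℂ) + a ≠ 0 := by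
  intro h
  have := congrArg Complex.im h
  simp at this
  exact ha this

/-- `conj F · G` is integrable for `F, G ∈ L²(ℝ)`. [folklore] -/
private theorem integrable_conj_mul (F G : Lp ℂ 2 (volume : Measure ℝ)) :
    Integrable (fun u : ℝ ↦ conj ((F : ℝ → ℂ) u) * (G : ℝ → ℂ) u) := by
  refine (L2.integrable_inner (𝕜 := ℂ) F G).congr (Eventually.of_forall fun u ↦ ?_)
  exact (RCLike.inner_apply _ _).trans (mul_comm _ _)

/-- **Inner products against `𝖥(C_v f)` by partial fractions**: if `conj A·(u − v)⁻¹ = c₁·conj B₁ + c₂·conj B₂`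
a.e. on `ℝ`, then `⟪A, 𝖥(C_v f)⟫ = c₁⟪B₁, 𝖥f⟫ + c₂⟪B₂, 𝖥f⟫` (the symbol is moved onto the test vector).
RH-FREE plumbing. [cite: Suzuki2025WeilHilbertSpace, CJM Thm. 5.7 proof p. 17 (TeX l.1929–1946)] -/
theorem inner_suzukiFourierL2_cauchyMul {v : ℂ} (hv : v.im ≠ 0) (f A B₁ B₂ : Lp ℂ 2 (volume : Measure ℝ))
    {c₁ c₂ : ℂ} (hae : ∀ᵐ u : ℝ, conj ((A : ℝ → ℂ) u) * (1 / ((u : ℂ) - v)) =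
      c₁ * conj ((B₁ : ℝ → ℂ) u) + c₂ * conj ((B₂ : ℝ → ℂ) u)) :
    inner ℂ A (suzukiFourierL2 (cauchyMul v f)) =
      c₁ * inner ℂ B₁ (suzukiFourierL2 f) + c₂ * inner ℂ B₂ (suzukiFourierL2 f) := by
  set F : Lp ℂ 2 (volume : Measure ℝ) := suzukiFourierL2 f with hF
  rw [inner_L2_eq_integral, inner_L2_eq_integral, inner_L2_eq_integral, ← integral_const_mul,
    ← integral_const_mul, ← integral_add ((integrable_conj_mul B₁ F).const_mul c₁)
      ((integrable_conj_mul B₂ F).const_mul c₂)]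
  refine integral_congr_ae ?_
  filter_upwards [suzukiFourierL2_cauchyMul hv f, hae] with u e1 e2
  rw [e1, ← mul_assoc, e2]
  ring

/-- **`(C_w f)^(z) = (f̂(z) − f̂(w))/(z − w)`** for `w, z ∈ ℂ₊`, `z ≠ w`, every `f ∈ L²(ℝ)`
(`(u−w̄)⁻¹·𝖥e_z = (w̄ − z̄)⁻¹(𝖥e_w − 𝖥e_z)` and `f̂(·) = (2π)⁻¹⟪𝖥e_·, 𝖥f⟫`). RH-FREE.
[cite: Suzuki2025WeilHilbertSpace, CJM Thm. 5.7 proof p. 17 (TeX l.1929–1935: "(𝖥f_w)(z) = ((z−w̄)/(z−w))(𝖥f)(z) for z ∈ ℂ₊")] -/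
theorem upperHalfHat_cauchyMul_of_im_pos {w : ℂ} (hw : 0 < w.im) (f : Lp ℂ 2 (volume : Measure ℝ))
    {z : ℂ} (hz : 0 < z.im) (hzw : z ≠ w) :
    upperHalfHat (cauchyMul w f) z = (upperHalfHat f z - upperHalfHat f w) / (z - w) := by
  have hwz : w - z ≠ 0 := sub_ne_zero.2 (Ne.symm hzw)
  have key := inner_suzukiFourierL2_cauchyMul hw.ne' f (suzukiFourierL2 (cauchyVec z))
    (suzukiFourierL2 (cauchyVec w)) (suzukiFourierL2 (cauchyVec z))
    (c₁ := 1 / (w - z)) (c₂ := -(1 / (w - z))) (by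
      filter_upwards [suzukiFourierL2_cauchyVec hz, suzukiFourierL2_cauchyVec hw] with u e1 e2
      rw [e1, e2]
      have h1 := ofReal_sub_ne_zero hz.ne' u
      have h2 := ofReal_sub_ne_zero hw.ne' u
      have h1' : (u : ℂ) - conj z ≠ 0 := ofReal_sub_ne_zero (by simpa using hz.ne') u
      have h2' : (u : ℂ) - conj w ≠ 0 := ofReal_sub_ne_zero (by simpa using hw.ne') u
      simp only [map_div₀, Complex.conj_I, map_sub, Complex.conj_ofReal, Complex.conj_conj]
      field_simp
      ring)
  rw [upperHalfHat_eq_inner_fourier _ hz, key, upperHalfHat_eq_inner_fourier f hz,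
    upperHalfHat_eq_inner_fourier f hw]
  have hπ : ((2 * Real.pi)⁻¹ : ℂ) ≠ 0 := by
    exact_mod_cast inv_ne_zero Real.two_pi_pos.ne'
  have hzw' : z - w ≠ 0 := sub_ne_zero.2 hzw
  field_simp
  ring

/-- **`(C_v f)^(z) = f̂(z)/(z − v)`** for `v ∈ ℂ₋`, `z ∈ ℂ₊`, `f ∈ L²(0,∞)` (the extra partial-fraction
term is `𝖥ě_{−v,0} ∈ 𝖥(L²(−∞,0))`, orthogonal to `𝖥f`). RH-FREE.
[cite: Suzuki2025WeilHilbertSpace, CJM Thm. 5.7 proof p. 17 (TeX l.1940–1946: "(𝖥g_w)(z) = ((z−w)/(z−w̄))(𝖥𝖪f)(z)")] -/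
theorem upperHalfHat_cauchyMul_of_im_neg {v : ℂ} (hv : v.im < 0) {f : Lp ℂ 2 (volume : Measure ℝ)}
    (hf : f ∈ halfLineL2 0) {z : ℂ} (hz : 0 < z.im) :
    upperHalfHat (cauchyMul v f) z = upperHalfHat f z / (z - v) := by
  have hv' : 0 < (-v).im := by simp; linarith
  have hvz : v - z ≠ 0 := by
    intro h; have := congrArg Complex.im h; simp at this; linarith
  have key := inner_suzukiFourierL2_cauchyMul hv.ne f (suzukiFourierL2 (cauchyVec z))
    (suzukiFourierL2 (cauchyVecR (-v) 0)) (suzukiFourierL2 (cauchyVec z))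
    (c₁ := -(1 / (v - z))) (c₂ := -(1 / (v - z))) (by
      filter_upwards [suzukiFourierL2_cauchyVec hz, suzukiFourierL2_cauchyVecR hv' 0] with u e1 e2
      rw [e1, e2]
      have h1 := ofReal_sub_ne_zero hz.ne' u
      have h2 := ofReal_sub_ne_zero hv.ne u
      have h1' : (u : ℂ) - conj z ≠ 0 := ofReal_sub_ne_zero (by simpa using hz.ne') u
      have h2' : (u : ℂ) + conj (-v) ≠ 0 := ofReal_add_ne_zero (by simp; exact hv.ne) u
      have h2'' : (u : ℂ) + -v ≠ 0 := ofReal_add_ne_zero (by simp; exact hv.ne) u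
      simp only [map_div₀, map_neg, Complex.conj_I, map_sub, map_add, Complex.conj_ofReal,
        Complex.conj_conj, Complex.ofReal_zero, mul_zero, Complex.exp_zero, mul_one]
      simp only [map_neg] at h2'
      field_simp
      ring)
  have horth : inner ℂ (suzukiFourierL2 (cauchyVecR (-v) 0)) (suzukiFourierL2 f) = 0 := by
    rw [inner_suzukiFourierL2, inner_cauchyVecR_eq_zero_of_mem hv' hf, mul_zero]
  rw [upperHalfHat_eq_inner_fourier _ hz, key, horth, upperHalfHat_eq_inner_fourier f hz]
  have hzv : z - v ≠ 0 := fun h ↦ hvz (by rw [← neg_sub, h, neg_zero])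
  field_simp
  ring

/-! ## D. Support: `C_v` preserves `L²(t,∞)` (`v ∈ ℂ₋`; or `v = w ∈ ℂ₊` when `f̂(w) = 0`) -/

/-- **`C_v(L²(t,∞)) ⊆ L²(t,∞)` for `v ∈ ℂ₋`, `t ≥ 0`** (Suzuki: "`g_w` has support in `[t,∞)` by
`𝖪f ∈ L²(t,∞)`"): tested against the reflected Cauchy vectors `ě_{a,t}` (exceptional point `a = −v`
by continuity), the partial fraction `(u−v̄)⁻¹·𝖥ě_{a,t} ∈ span{𝖥ě_{−v,t}, 𝖥ě_{a,t}} ⊂ 𝖥(L²(−∞,t))`.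
RH-FREE. [cite: Suzuki2025WeilHilbertSpace, CJM Thm. 5.7 proof p. 17 (TeX l.1940–1944)] -/
theorem cauchyMul_mem_halfLineL2_of_im_neg {v : ℂ} (hv : v.im < 0) {t : ℝ}
    {f : Lp ℂ 2 (volume : Measure ℝ)} (hf : f ∈ halfLineL2 t) : cauchyMul v f ∈ halfLineL2 t := by
  have hv' : 0 < (-v).im := by simp; linarith
  refine mem_halfLineL2_of_inner_cauchyVecR_eq_zero (-v) fun a ha hne ↦ ?_
  have hav : a + v ≠ 0 := fun h ↦ hne (eq_neg_of_add_eq_zero_left h)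
  have key := inner_suzukiFourierL2_cauchyMul hv.ne f (suzukiFourierL2 (cauchyVecR a t))
    (suzukiFourierL2 (cauchyVecR (-v) t)) (suzukiFourierL2 (cauchyVecR a t))
    (c₁ := 1 / (a + v)) (c₂ := -(1 / (a + v))) (by
      filter_upwards [suzukiFourierL2_cauchyVecR ha t, suzukiFourierL2_cauchyVecR hv' t] with u e1 e2
      rw [e1, e2]
      have h1 : (u : ℂ) + a ≠ 0 := ofReal_add_ne_zero ha.ne' u
      have h2 := ofReal_sub_ne_zero hv.ne u
      have h3 : (u : ℂ) + -v ≠ 0 := ofReal_add_ne_zero (by simp; exact hv.ne) u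
      simp only [map_div₀, map_neg, map_mul, Complex.conj_I, map_add, Complex.conj_ofReal,
        Complex.conj_conj, ← Complex.exp_conj]
      field_simp
      ring)
  have h1 : inner ℂ (suzukiFourierL2 (cauchyVecR (-v) t)) (suzukiFourierL2 f) = 0 := by
    rw [inner_suzukiFourierL2, inner_cauchyVecR_eq_zero_of_mem hv' hf, mul_zero]
  have h2 : inner ℂ (suzukiFourierL2 (cauchyVecR a t)) (suzukiFourierL2 f) = 0 := by
    rw [inner_suzukiFourierL2, inner_cauchyVecR_eq_zero_of_mem ha hf, mul_zero]
  have h3 := inner_suzukiFourierL2 (cauchyVecR a t) (cauchyMul v f)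
  rw [key, h1, h2, mul_zero, mul_zero, add_zero] at h3
  have hπ : ((2 * Real.pi : ℝ) : ℂ) ≠ 0 := by exact_mod_cast Real.two_pi_pos.ne'
  exact (mul_eq_zero.1 h3.symm).resolve_left hπ

/-- **`C_w(f) ∈ L²(t,∞)` for `w ∈ ℂ₊`, `t ≥ 0`, `f ∈ L²(t,∞)` with `f̂(w) = 0`** (Suzuki: "we easily
find that `f_w ∈ L²(t,∞)`"): the partial fraction `(u−w̄)⁻¹·𝖥ě_{a,t} ∈ span{𝖥e_{w,t}, 𝖥ě_{a,t}}`
and `⟪e_{w,t}, f⟫ = e^{−iwt}f̂(w) = 0`. RH-FREE.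
[cite: Suzuki2025WeilHilbertSpace, CJM Thm. 5.7 proof p. 17 (TeX l.1929–1935)] -/
theorem cauchyMul_mem_halfLineL2_of_im_pos {w : ℂ} (hw : 0 < w.im) {t : ℝ} (ht : 0 ≤ t)
    {f : Lp ℂ 2 (volume : Measure ℝ)} (hf : f ∈ halfLineL2 t) (hfw : upperHalfHat f w = 0) :
    cauchyMul w f ∈ halfLineL2 t := by
  refine mem_halfLineL2_of_inner_cauchyVecR_eq_zero w fun a ha _ ↦ ?_
  have haw : a + w ≠ 0 := by
    intro h; have := congrArg Complex.im h; simp at this; linarith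
  have key := inner_suzukiFourierL2_cauchyMul hw.ne' f (suzukiFourierL2 (cauchyVecR a t))
    (suzukiFourierL2 (cauchyVecT w t)) (suzukiFourierL2 (cauchyVecR a t))
    (c₁ := -(1 / (a + w))) (c₂ := -(1 / (a + w))) (by
      filter_upwards [suzukiFourierL2_cauchyVecR ha t, suzukiFourierL2_cauchyVecT hw t] with u e1 e2
      rw [e1, e2]
      have h1 : (u : ℂ) + a ≠ 0 := ofReal_add_ne_zero ha.ne' u
      have h2 := ofReal_sub_ne_zero hw.ne' u
      simp only [map_div₀, map_neg, map_mul, Complex.conj_I, map_add, map_sub, Complex.conj_ofReal,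
        Complex.conj_conj, ← Complex.exp_conj]
      field_simp
      ring)
  have h1 : inner ℂ (suzukiFourierL2 (cauchyVecT w t)) (suzukiFourierL2 f) = 0 := by
    rw [inner_suzukiFourierL2, inner_cauchyVecT hw ht hf, hfw, mul_zero, mul_zero]
  have h2 : inner ℂ (suzukiFourierL2 (cauchyVecR a t)) (suzukiFourierL2 f) = 0 := by
    rw [inner_suzukiFourierL2, inner_cauchyVecR_eq_zero_of_mem ha hf, mul_zero]
  have h3 := inner_suzukiFourierL2 (cauchyVecR a t) (cauchyMul w f)
  rw [key, h1, h2, mul_zero, add_zero] at h3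
  have hπ : ((2 * Real.pi : ℝ) : ℂ) ≠ 0 := by exact_mod_cast Real.two_pi_pos.ne'
  exact (mul_eq_zero.1 h3.symm).resolve_left hπ

/-! ## E. The Blaschke shift on `V(t)` -/

/-- `upperHalfHat` is additive on `L²(ℝ)` (from the cell's `upperHalfHat_sub`). [cite: Suzuki2025WeilHilbertSpace, CJM eq. (1.1) p. 2] -/
theorem upperHalfHat_add (f g : Lp ℂ 2 (volume : Measure ℝ)) {z : ℂ} (hz : 0 < z.im) :
    upperHalfHat (↑(f + g)) z = upperHalfHat f z + upperHalfHat g z := by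
  have h := upperHalfHat_sub (f + g) g hz
  rw [add_sub_cancel_right] at h
  rw [h, sub_add_cancel]

/-- **Suzuki's `f_w := f + (w − w̄)·C_w f` lies in `V(t)`** for `f ∈ V(t)` (`t ≥ 0`), `w ∈ ℂ₊` with
`f̂(w) = 0`: `f_w ∈ L²(t,∞)` by `cauchyMul_mem_halfLineL2_of_im_pos`, and
`𝖪f_w = 𝖪f + (w̄ − w)·C_{w̄}(𝖪f) ∈ L²(t,∞)` (`𝖪` conjugate-linear, `𝖪C_w = C_{w̄}𝖪`,
`cauchyMul_mem_halfLineL2_of_im_neg`) — the printed `g_w = 𝖪f_w`. RH-FREE.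
[cite: Suzuki2025WeilHilbertSpace, CJM Thm. 5.7 proof p. 17 (TeX l.1929–1946)] -/
theorem blaschkeShift_mem_suzukiV {t : ℝ} (ht : 0 ≤ t) {f : Lp ℂ 2 (volume : Measure ℝ)}
    (hf : f ∈ suzukiV t) {w : ℂ} (hw : 0 < w.im) (hfw : upperHalfHat f w = 0) :
    f + (w - conj w) • cauchyMul w f ∈ suzukiV t := by
  rw [mem_suzukiV_iff] at hf ⊢
  obtain ⟨hfL, hKfL⟩ := hf
  have hw' : (conj w).im < 0 := by simp [hw]
  refine ⟨add_mem_halfLineL2 hfL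
    (smul_mem_halfLineL2 _ (cauchyMul_mem_halfLineL2_of_im_pos hw ht hfL hfw)), ?_⟩
  rw [suzukiK_add, suzukiK_smul, suzukiK_cauchyMul hw.ne']
  exact add_mem_halfLineL2 hKfL (smul_mem_halfLineL2 _ (cauchyMul_mem_halfLineL2_of_im_neg hw' hKfL))

/-- **`(f_w)^(z) = ((z − w̄)/(z − w))·f̂(z)` on `ℂ₊ ∖ {w}`** for `f̂(w) = 0`. RH-FREE.
[cite: Suzuki2025WeilHilbertSpace, CJM Thm. 5.7 proof p. 17 (TeX l.1929–1935)] -/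
theorem upperHalfHat_blaschkeShift {f : Lp ℂ 2 (volume : Measure ℝ)} {w : ℂ} (hw : 0 < w.im)
    (hfw : upperHalfHat f w = 0) {z : ℂ} (hz : 0 < z.im) (hzw : z ≠ w) :
    upperHalfHat (↑(f + (w - conj w) • cauchyMul w f)) z = (z - conj w) / (z - w) * upperHalfHat f z := by
  rw [upperHalfHat_add _ _ hz, upperHalfHat_smul, upperHalfHat_cauchyMul_of_im_pos hw f hz hzw, hfw,
    sub_zero]
  have hzw' : z - w ≠ 0 := sub_ne_zero.2 hzw
  field_simp
  ring

end SuzukiBlaschke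

end Literature.NumberTheory.LFunctions

end
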